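import Mathlib
import Summits.MatrixMultiplication.MatrixMultiplication.Theses.PauliSmithLocalisation
import Summits.MatrixMultiplication.MatrixMultiplication.Theses.BorderRankLowerBound
import Summits.MatrixMultiplication.MatrixMultiplication.Theorems.PauliSmithLocalisationFixedPointFreeTargetsOfSmithPhaseGap
import Summits.MatrixMultiplication.MatrixMultiplication.Theorems.PauliSmithLocalisationSuperquadraticInfinitelyOften
import Literature.Computability.AlgebraicComplexity.BorderRankMatMulSmallLMProofs
import Literature.Computability.AlgebraicComplexity.BorderRankMatMulTwoHolds
import Literature.Computability.AlgebraicComplexity.AsymptoticRankMatMul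
import Literature.Computability.AlgebraicComplexity.AsymptoticRankBorderRank

/-!
# Line `BorderRankTwoNSquared` for crux `FixedPointFreeTargets` (stmt-MatrixMultiplication-15042):
the ladder-down rung `bR(⟨n,n,n⟩) ≥ 2n²` and its Landsberg–Michałek skeleton

Forward generator G4 (ladder-down).  The crux `FixedPointFreeTargets` (fixed-point-free `E`-targets on
every border-rank level `r ≤ n^(2+δ)`, `n = p^k`) is summit-strength: the tree proves
`FixedPointFreeTargets ↔ SmithPhaseGap` (`Theorems.fixedPointFreeTargets_iff_smithPhaseGap`) and
`SmithPhaseGap ↔ 2 < ω(ℂ) ↔ ¬ MatrixMultiplication` (`Cruxes/FixedPointFreeTargets/Disproof.lean`,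
`smithPhaseGap_iff_two_lt_omega`).  By the levelwise dictionary
(`PauliTautologicalTarget.targets_of_lt_algBorderRank`: a target exists at every level
`r < bR ⟨p^k,p^k,p^k⟩`; `Disproof.noTarget_of_algBorderRank_le`: none at any level `r ≥ bR`) the
crux's ladder IS the ladder of border-rank lower bounds for `⟨n,n,n⟩`, graded by the DEFICIT
`t(n)` in `2n² ≤ bR(⟨n,n,n⟩) + t(n)` (`DeficitRung t`).

* FLOOR (in tree, sorry-free): `DeficitRung (⌈log₂ n⌉ + 1)` — Landsberg–Michałek 2018, Thm. 1.1,
  `LandsbergMichalek2018_borderRank_matMulTensor_holds` (`deficitRung_floor`).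
* RUNG filed here: `BorderRankTwoNSquared : ∃ n₀, ∀ n ≥ n₀, 2n² ≤ bR(⟨n,n,n⟩)` = `DeficitRung 0`
  (`borderRankTwoNSquared_iff_deficitRung_zero`).  The located stopping point: LM18, §1 (last
  paragraph): "none of the existing techniques appear to be able to prove a border rank lower bound of
  `2n²` for matrix multiplication"; the eventual quantifier is forced (`bR(⟨2,2,2⟩) = 7 < 8`,
  `not_twoNSq_from_two`).
* LOGICAL POSITION (all proved below): `FixedPointFreeTargets → BorderRankTwoNSquared`
  (`rung_of_crux`, on path: crux ⇒ `ω > 2` ⇒ `bR ≥ n^ω ≥ 2n²` eventually, Bini — stated on the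
  definitionally-equal `DeficitRung 0` and by name as an `example`, so that `BorderRankTwoNSquared_of`
  is the ONLY theorem concluding the rung declaration, as the skeleton audit requires);
  the converse and `BorderRankTwoNSquared → ¬ MatrixMultiplication` are NOT claimed (the rung is
  compatible with `ω = 2`; probes in `bc/`).  In the crux's own language the rung reads: for every
  prime `p`, eventually in `k`, fixed-point-free `E`-targets exist at EVERY level `r < 2 (p^k)²`
  (`targetsBelow_of_rung`), against the crux's `r ≤ (p^k)^(2+δ)` and the floor's
  `r < 2(p^k)² − ⌈log₂ p^k⌉ − 1` (`targetsBelow_floor`).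
* SKELETON (Landsberg–Michałek architecture at the critical size `m = n`): LM18 Part 1 is in tree for
  every `m < n²` (`exists_isLowerSet_algBorderRank_add_le`: a Young diagram `λ`, `|λ| = m`, with
  `bR(⟨n,n,n⟩^λ) + m ≤ bR(⟨n,n,n⟩)`); LM18 Part 2 (Koszul) gives `bR(⟨n,n,n⟩^λ) ≥ (2n−1)n − loss(λ)`,
  so the architecture reaches `2n²` exactly when `m = n` AND Part 2 is lossless — and at `m = n` two
  things happen at once: the Young diagram may for the first time be a full row / column (then
  `⟨n,n,n⟩^λ` is the rectangular tensor `⟨n−1,n,n⟩` / `⟨n,n,n−1⟩` padded by zeros), and the reduced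
  Koszul flattening is lossy for every diagram (`g ≥ 1` on every cell, `g = C(2n−2,n−1)` at the far
  cell of a row).  Hence two stubs, neither implied by the rung nor implying it alone:
  `stub_rowColumn` (the rectangular sub-rung `bR(⟨n−1,n,n⟩) ≥ 2n² − n`, stated on the padded tensors)
  and `stub_staircase` (the same bound for the proper staircases), composed in
  `deficitRung_zero_of_bounds` through the in-tree Part 1; `BorderRankTwoNSquared_of : BorderRankTwoNSquared`
  concludes the rung by name from the two registered stubs.
-/

set_option linter.dupNamespace false

noncomputable section

open Filter
open scoped BigOperators ComplexConjugate

namespace Summit.MatrixMultiplication.MatrixMultiplication.Cruxes.FixedPointFreeTargets.BorderRankTwoNSquared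

open Literature.Computability.AlgebraicComplexity
open Summit.MatrixMultiplication.MatrixMultiplication.Theses.PauliSmithLocalisation
open Summit.MatrixMultiplication.MatrixMultiplication.Theorems

/-! ## The ladder family and the rung -/

/-- **Deficit rungs.** `DeficitRung t`: eventually `2n² ≤ bR(⟨n,n,n⟩) + t(n)` over `ℂ` — the ladder of
the crux in border-rank coordinates, graded by the deficit `t` below `2n²`
(LM18 floor: `t = ⌈log₂ n⌉ + 1`; this rung: `t = 0`). [cite: LandsbergMichalek2018, Thm. 1.1] -/
def DeficitRung (t : ℕ → ℕ) : Prop :=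
  ∃ n₀ : ℕ, ∀ n : ℕ, n₀ ≤ n → 2 * n ^ 2 ≤ algBorderRank (matMulTensor ℂ n n n) + t n

/-- **The rung `R_{2n²}`** (next rung above the LM18 floor, first open one): eventually
`2n² ≤ bR(⟨n,n,n⟩)` for Bläser's algebraic border rank over `ℂ[ε]`.  LM18, §1: "none of the existing
techniques appear to be able to prove a border rank lower bound of `2n²`".
[cite: LandsbergMichalek2018, §1 (last paragraph) and Thm. 1.1] -/
def BorderRankTwoNSquared : Prop :=
  ∃ n₀ : ℕ, ∀ n : ℕ, n₀ ≤ n → 2 * n ^ 2 ≤ algBorderRank (matMulTensor ℂ n n n)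

/-- The rung is the deficit-`0` member of the family. [folklore] -/
theorem borderRankTwoNSquared_iff_deficitRung_zero : BorderRankTwoNSquared ↔ DeficitRung 0 := by
  simp [BorderRankTwoNSquared, DeficitRung]

/-- Monotonicity of the ladder: a smaller deficit is a higher rung. [folklore] -/
theorem DeficitRung.mono {t t' : ℕ → ℕ} (h : DeficitRung t) (htt' : ∀ n, t n ≤ t' n) :
    DeficitRung t' := by
  obtain ⟨n₀, hn₀⟩ := h
  exact ⟨n₀, fun n hn => (hn₀ n hn).trans (by have := htt' n; omega)⟩

/-- **FLOOR (in tree):** `DeficitRung (⌈log₂ n⌉ + 1)`, i.e. `bR(⟨n,n,n⟩) ≥ 2n² − ⌈log₂ n⌉ − 1` for all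
`n ≥ 1` — Landsberg–Michałek 2018, Thm. 1.1, fully proved in the tree
(`LandsbergMichalek2018_borderRank_matMulTensor_holds`). [cite: LandsbergMichalek2018, Thm. 1.1] -/
theorem deficitRung_floor : DeficitRung fun n => Nat.clog 2 n + 1 :=
  ⟨1, fun n hn => by
    simpa [add_assoc] using LandsbergMichalek2018_borderRank_matMulTensor_holds n hn⟩

/-- **Tightness of the eventual quantifier:** `2n² ≤ bR(⟨n,n,n⟩)` fails at `n = 2`
(`bR(⟨2,2,2⟩) = 7`, Landsberg 2006), so the rung cannot start below `n₀ = 3`.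
[cite: Landsberg2005, main theorem (p. 447)] -/
theorem not_twoNSq_from_two :
    ¬ ∀ n : ℕ, 2 ≤ n → 2 * n ^ 2 ≤ algBorderRank (matMulTensor ℂ n n n) := by
  intro h
  have h2 := h 2 le_rfl
  rw [algBorderRank_matMulTensor_two ℂ] at h2
  omega

/-! ## The skeleton: Landsberg–Michałek at the critical size `m = n` -/

/-- The row lower set `{(0, y)}` of the first factor `Fin n × Fin n` of `⟨n,n,n⟩` (outputs `Z_{0ν}`):
deleting it leaves `⟨n−1,n,n⟩` padded by zeros. [cite: LandsbergMichalek2018, §3 (notation M^λ)] -/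
def rowZero (n : ℕ) : Finset (Fin n × Fin n) := Finset.univ.filter fun a => (a.1 : ℕ) = 0

/-- The column lower set `{(x, 0)}` (outputs `Z_{κ0}`): deleting it leaves `⟨n,n,n−1⟩` padded by
zeros. [cite: LandsbergMichalek2018, §3 (notation M^λ)] -/
def colZero (n : ℕ) : Finset (Fin n × Fin n) := Finset.univ.filter fun a => (a.2 : ℕ) = 0

/-- **Stub statement (i), the rectangular sub-rung:** eventually
`2n² − n ≤ bR(⟨n,n,n⟩^{row 0}) = bR(⟨n−1,n,n⟩)` and the same for the column
(`= bR(⟨n,n,n−1⟩)`), i.e. the "two factor dimensions" bound `n² + n(n−1)` one notch down the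
rectangular ladder.  Known: `≥ 2n² − 2n − ⌈log₂ n⌉ − O(1)` (LM18 Thm. 1.1 with `w = n − 1`); false at
`n = 2, 3` (`bR(⟨1,2,2⟩) = 4`, `bR(⟨2,3,3⟩) = 14`, CHL23 Thm. 1.4), hence eventual.
[cite: LandsbergMichalek2018, Thm. 1.1] [cite: ConnerHarperLandsberg2023, Thm. 1.4] -/
def RowColumnBound : Prop :=
  ∃ n₀ : ℕ, ∀ n : ℕ, n₀ ≤ n →
    2 * n ^ 2 ≤ algBorderRank (delSlices (rowZero n) (matMulTensor ℂ n n n)) + n ∧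
    2 * n ^ 2 ≤ algBorderRank (delSlices (colZero n) (matMulTensor ℂ n n n)) + n

/-- **Stub statement (ii), the staircase bound:** eventually, for every Young diagram `λ` (lower set of
`Fin n × Fin n`, corner `(0,0)`) with exactly `n` cells that is NOT the full row or column,
`2n² − n ≤ bR(⟨n,n,n⟩^λ)` — the lossless value `(2n−1)·n` of LM18 Part 2, which the reduced Koszul
flattening certifies only up to the loss `⌊n Σ_λ g / C(2n−2,n−1)⌋ ≥ 1` at this size.
[cite: LandsbergMichalek2018, §3 (Part 2) and §4] -/
def StaircaseBound : Prop :=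
  ∃ n₀ : ℕ, ∀ n : ℕ, n₀ ≤ n → ∀ D : Finset (Fin n × Fin n),
    IsLowerSet (D : Set (Fin n × Fin n)) → D.card = n → D ≠ rowZero n → D ≠ colZero n →
    2 * n ^ 2 ≤ algBorderRank (delSlices D (matMulTensor ℂ n n n)) + n

/-- Registered stub (i): the rectangular sub-rung. [cite: LandsbergMichalek2018, Thm. 1.1] -/
theorem stub_rowColumn : RowColumnBound := by
  sorry

/-- Registered stub (ii): the staircase bound. [cite: LandsbergMichalek2018, §3 (Part 2)] -/
theorem stub_staircase : StaircaseBound := by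
  sorry

/-- **Composition (kernel-checked): the two stubs give the rung** through LM18 Part 1 at `m = n`
(`exists_isLowerSet_algBorderRank_add_le`, in tree): for `n ≥ 2` there is a Young diagram `λ` with `n`
cells and `bR(⟨n,n,n⟩^λ) + n ≤ bR(⟨n,n,n⟩)`; it is the row, the column, or a proper staircase.
[cite: LandsbergMichalek2018, §3 (Part 1)] -/
theorem deficitRung_zero_of_bounds : RowColumnBound → StaircaseBound → DeficitRung 0 := by
  refine fun hrc hst => borderRankTwoNSquared_iff_deficitRung_zero.1 ?_
  obtain ⟨n₁, h₁⟩ := hrc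
  obtain ⟨n₂, h₂⟩ := hst
  refine ⟨max (max n₁ n₂) 2, fun n hn => ?_⟩
  have hn₁ : n₁ ≤ n := le_trans (le_trans (le_max_left _ _) (le_max_left _ _)) hn
  have hn₂ : n₂ ≤ n := le_trans (le_trans (le_max_right _ _) (le_max_left _ _)) hn
  have h2n : 2 ≤ n := le_trans (le_max_right _ _) hn
  have hw : 1 ≤ n := by omega
  have hlt : n < n * n := by nlinarith
  obtain ⟨D, hD, hcard, hle⟩ :=
    exists_isLowerSet_algBorderRank_add_le (K := ℂ) (n := n) (w := n) hw n hlt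
  by_cases hrow : D = rowZero n
  · subst hrow
    have := (h₁ n hn₁).1
    omega
  by_cases hcol : D = colZero n
  · subst hcol
    have := (h₁ n hn₁).2
    omega
  have := h₂ n hn₂ D hD hcard hrow hcol
  omega

/-- **The line concludes the rung BY NAME from the registered stubs** — the unique theorem of this
file whose conclusion is the rung declaration (the shape `ledger skeleton check` audits); every other
implication into the rung is stated on the definitionally-equal family member `DeficitRung 0`
(`borderRankTwoNSquared_iff_deficitRung_zero`) and restated by name as an `example`. [folklore] -/
theorem BorderRankTwoNSquared_of : BorderRankTwoNSquared :=
  borderRankTwoNSquared_iff_deficitRung_zero.2 (deficitRung_zero_of_bounds stub_rowColumn stub_staircase)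

example : RowColumnBound → StaircaseBound → BorderRankTwoNSquared :=
  fun h₁ h₂ => borderRankTwoNSquared_iff_deficitRung_zero.2 (deficitRung_zero_of_bounds h₁ h₂)


/-! ## Logical position: the crux implies the rung (on path) -/

/-- `2 < ω(ℂ)` gives the rung: `n^ω ≤ R̃(⟨n,n,n⟩) ≤ bR(⟨n,n,n⟩)` (ADVXXZ §3.4 / BCS Lemma 15.27, both in
tree) and `n^ω = n^(ω−2) · n² ≥ 2n²` as soon as `n^(ω−2) ≥ 2`. [cite: BurgisserClausenShokrollahi1997, Lemma (15.27)] -/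
theorem deficitRung_zero_of_two_lt_omega (hω : 2 < omega ℂ) : DeficitRung 0 := by
  refine borderRankTwoNSquared_iff_deficitRung_zero.1 ?_
  have hδ : 0 < omega ℂ - 2 := sub_pos.2 hω
  have ht : Tendsto (fun n : ℕ => ((n : ℝ)) ^ (omega ℂ - 2)) atTop atTop :=
    (tendsto_rpow_atTop hδ).comp tendsto_natCast_atTop_atTop
  obtain ⟨N, hN⟩ := eventually_atTop.1
    ((ht.eventually_ge_atTop 2).and (eventually_ge_atTop 1))
  refine ⟨N, fun n hn => ?_⟩
  obtain ⟨h2, h1⟩ := hN n hn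
  have hpos : (0 : ℝ) < n := by exact_mod_cast h1
  have key : (n : ℝ) ^ omega ℂ ≤ (algBorderRank (matMulTensor ℂ n n n) : ℝ) :=
    (rpow_omega_le_asymptoticRank_matMulTensor ℂ n).trans (asymptoticRank_le_algBorderRank _)
  have hsplit : (n : ℝ) ^ omega ℂ = (n : ℝ) ^ (omega ℂ - 2) * (n : ℝ) ^ (2 : ℕ) := by
    rw [← Real.rpow_natCast, ← Real.rpow_add hpos]
    congr 1
    push_cast
    ring
  have h3 : (2 : ℝ) * (n : ℝ) ^ 2 ≤ (n : ℝ) ^ omega ℂ := by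
    rw [hsplit]
    exact mul_le_mul_of_nonneg_right h2 (pow_nonneg hpos.le 2)
  exact_mod_cast h3.trans key

/-- `SmithPhaseGap → 2 < ω(ℂ)`: the gap `(p^k)^(2+δ) < bR ≤ R` infinitely often forces `2 + δ ≤ ω`
(`add_le_omega_of_io_superquadratic`, in tree). [folklore] [cite: Blaser2013, Def. 5.1] -/
theorem two_lt_omega_of_smithPhaseGap (h : SmithPhaseGap) : 2 < omega ℂ := by
  obtain ⟨p, hp, δ, hδ, k₀, hk⟩ := h
  have hio : ∀ n₀ : ℕ, ∃ n : ℕ, n₀ ≤ n ∧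
      (n : ℝ) ^ (2 + δ) < (tensorRank (matMulTensor ℂ n n n) : ℝ) := by
    intro n₀
    refine ⟨p ^ max k₀ n₀, ?_, ?_⟩
    · exact (le_max_right k₀ n₀).trans (Nat.lt_pow_self hp.one_lt).le
    · exact (hk _ (le_max_left _ _)).trans_le (by exact_mod_cast algBorderRank_le_tensorRank _)
  have h2 := add_le_omega_of_io_superquadratic hio
  linarith

/-- **ON PATH: the crux implies the rung**, `FixedPointFreeTargets → BorderRankTwoNSquared`
(targets ⇒ Smith phase gap ⇒ `ω > 2` ⇒ Bini). [folklore] [cite: Blaser2013, §6] -/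
theorem rung_of_crux (h : FixedPointFreeTargets) : DeficitRung 0 :=
  deficitRung_zero_of_two_lt_omega
    (two_lt_omega_of_smithPhaseGap (fixedPointFreeTargets_iff_smithPhaseGap.1 h))

-- ON PATH, by name: the crux implies the rung declaration.
example : FixedPointFreeTargets → BorderRankTwoNSquared :=
  fun h => borderRankTwoNSquared_iff_deficitRung_zero.2 (rung_of_crux h)

/-- The negated summit also implies the rung (`¬(ω = 2)` ⇒ `ω > 2` since `ω ≥ 2`), so the rung is a
consequence of BOTH the crux and `¬ MatrixMultiplication`; it is not known to follow from
`MatrixMultiplication`. [folklore] -/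
theorem rung_of_not_matrixMultiplication (h : ¬ _root_.MatrixMultiplication) : DeficitRung 0 := by
  rw [_root_.MatrixMultiplication_iff] at h
  exact deficitRung_zero_of_two_lt_omega (lt_of_le_of_ne (omega_two_le (K := ℂ)) (Ne.symm h))

example : ¬ _root_.MatrixMultiplication → BorderRankTwoNSquared :=
  fun h => borderRankTwoNSquared_iff_deficitRung_zero.2 (rung_of_not_matrixMultiplication h)

/-- **The rung is shared with the FRONTIER ladder of route `BorderRankLowerBound`:** it is the
`C = 2` instance of its crux `FSuperlinearExplicitBorderRank` (stmt-MatrixMultiplication-0655,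
`∀ C, ∀ᶠ n, C·n² ≤ bR(⟨n,n,n⟩)`), the nearest existing item; that crux does NOT give
`FixedPointFreeTargets` (superlinear-in-the-format is compatible with `ω = 2`). [folklore] -/
theorem rung_of_superlinear (h : Theses.BorderRankLowerBound.FSuperlinearExplicitBorderRank) :
    DeficitRung 0 := by
  refine borderRankTwoNSquared_iff_deficitRung_zero.1 ?_
  obtain ⟨N, hN⟩ := eventually_atTop.1 (h 2)
  refine ⟨N, fun n hn => ?_⟩
  have := hN n hn
  exact_mod_cast this

example : Theses.BorderRankLowerBound.FSuperlinearExplicitBorderRank → BorderRankTwoNSquared :=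
  fun h => borderRankTwoNSquared_iff_deficitRung_zero.2 (rung_of_superlinear h)

/-! ## The gap above the rung: polynomial surplus is the crux again -/

/-- **GAP (typed): polynomial surplus** — eventually `n^(2+δ) ≤ bR(⟨n,n,n⟩)` for some `δ > 0`; the
first member of the surplus ladder `2n² + s(n) ≤ bR` (`s = 0`: this rung; `s = (c−2)n²` for every `c`:
the FRONTIER items `BorderRankLowerBound.*`, which do NOT give the crux) that reaches the crux — and it
is crux-EQUIVALENT (`polySurplus_iff_crux`), so the honest ladder `rung → gap → crux` does not consume
the rung: the rung is filed as a LINE, not as a route. [cite: Blaser2013, §6] -/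
def PolySurplus : Prop :=
  ∃ δ : ℝ, 0 < δ ∧ ∃ n₀ : ℕ, ∀ n : ℕ, n₀ ≤ n →
    (n : ℝ) ^ (2 + δ) ≤ (algBorderRank (matMulTensor ℂ n n n) : ℝ)

/-- `2 < ω(ℂ)` ⇒ polynomial surplus (`δ = (ω − 2)/2`, Bini). [cite: BurgisserClausenShokrollahi1997, Lemma (15.27)] -/
theorem polySurplus_of_two_lt_omega (hω : 2 < omega ℂ) : PolySurplus := by
  refine ⟨(omega ℂ - 2) / 2, by linarith, 1, fun n hn => ?_⟩
  have h1 : (1 : ℝ) ≤ n := by exact_mod_cast hn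
  calc (n : ℝ) ^ (2 + (omega ℂ - 2) / 2) ≤ (n : ℝ) ^ omega ℂ :=
        Real.rpow_le_rpow_of_exponent_le h1 (by linarith)
    _ ≤ _ := (rpow_omega_le_asymptoticRank_matMulTensor ℂ n).trans (asymptoticRank_le_algBorderRank _)

/-- Polynomial surplus ⇒ `2 < ω(ℂ)` (`bR ≤ R`, then `add_le_omega_of_io_superquadratic` with exponent
`2 + δ/2`). [folklore] [cite: Blaser2013, Def. 5.1] -/
theorem two_lt_omega_of_polySurplus (h : PolySurplus) : 2 < omega ℂ := by
  obtain ⟨δ, hδ, n₀, hn₀⟩ := h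
  have hio : ∀ m : ℕ, ∃ n : ℕ, m ≤ n ∧
      (n : ℝ) ^ (2 + δ / 2) < (tensorRank (matMulTensor ℂ n n n) : ℝ) := by
    intro m
    refine ⟨max (max m n₀) 2, le_trans (le_max_left _ _) (le_max_left _ _), ?_⟩
    set n := max (max m n₀) 2 with hn
    have hn₀' : n₀ ≤ n := le_trans (le_max_right _ _) (le_max_left _ _)
    have h2 : (1 : ℝ) < n := by exact_mod_cast (lt_of_lt_of_le one_lt_two (le_max_right _ _))
    calc (n : ℝ) ^ (2 + δ / 2) < (n : ℝ) ^ (2 + δ) :=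
          Real.rpow_lt_rpow_of_exponent_lt h2 (by linarith)
      _ ≤ (algBorderRank (matMulTensor ℂ n n n) : ℝ) := hn₀ n hn₀'
      _ ≤ _ := by exact_mod_cast algBorderRank_le_tensorRank _
  have := add_le_omega_of_io_superquadratic hio
  linarith

/-- `2 < ω(ℂ)` ⇒ the crux (Smith phase gap along `p = 2`, `δ = (ω−2)/2`, then the tautological target,
both in tree). [cite: Blaser2013, §6] -/
theorem crux_of_two_lt_omega (hω : 2 < omega ℂ) : FixedPointFreeTargets := by
  refine fixedPointFreeTargets_iff_smithPhaseGap.2 ⟨2, Nat.prime_two, (omega ℂ - 2) / 2, by linarith, 1,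
    fun k hk => ?_⟩
  have hgt : (1 : ℝ) < ((2 ^ k : ℕ) : ℝ) := by
    exact_mod_cast Nat.one_lt_two_pow (by omega)
  calc ((2 ^ k : ℕ) : ℝ) ^ (2 + (omega ℂ - 2) / 2) < ((2 ^ k : ℕ) : ℝ) ^ omega ℂ :=
        Real.rpow_lt_rpow_of_exponent_lt hgt (by linarith)
    _ ≤ _ := (rpow_omega_le_asymptoticRank_matMulTensor ℂ (2 ^ k)).trans
        (asymptoticRank_le_algBorderRank _)

/-- **The crux in border-rank coordinates is `ω(ℂ) > 2`** (re-derived here from `Theorems/` only; the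
`Disproof.lean` of the crux directory proves the same as `fixedPointFreeTargets_iff_two_lt_omega`). [cite: Blaser2013, §6] -/
theorem crux_iff_two_lt_omega : FixedPointFreeTargets ↔ 2 < omega ℂ :=
  ⟨fun h => two_lt_omega_of_smithPhaseGap (fixedPointFreeTargets_iff_smithPhaseGap.1 h),
    crux_of_two_lt_omega⟩

/-- **The gap is the crux:** `PolySurplus ↔ FixedPointFreeTargets`. [cite: Blaser2013, §6] -/
theorem polySurplus_iff_crux : PolySurplus ↔ FixedPointFreeTargets :=
  ⟨fun h => crux_of_two_lt_omega (two_lt_omega_of_polySurplus h),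
    fun h => polySurplus_of_two_lt_omega (crux_iff_two_lt_omega.1 h)⟩

/-- On path through the gap: `PolySurplus → BorderRankTwoNSquared`. [folklore] -/
theorem rung_of_polySurplus (h : PolySurplus) : DeficitRung 0 :=
  deficitRung_zero_of_two_lt_omega (two_lt_omega_of_polySurplus h)

example : PolySurplus → BorderRankTwoNSquared :=
  fun h => borderRankTwoNSquared_iff_deficitRung_zero.2 (rung_of_polySurplus h)

/-- **The typed ladder `rung → gap → crux`.** Honest reading: the gap alone gives the crux (the rung
binder is not consumed), because no graded family of border-rank rungs strictly between `2n²` and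
`n^(2+δ)` reaches the crux — every `c·n²` rung is compatible with `ω = 2`. [folklore] -/
theorem crux_of_ladder : BorderRankTwoNSquared → PolySurplus → FixedPointFreeTargets :=
  fun _ h => polySurplus_iff_crux.1 h

/-! ## The rung in the crux's own language: targets below level `2n²` -/

/-- **Targets below a level function `L`.** For every prime `p`, eventually in `k`, the pinned Pauli
sandwich action of `E = (𝔽_p^(2k))³` admits a fixed-point-free `E`-target on `S_r ∖ {0}` at EVERY
level `r < L(p^k)` (same binders as the crux `FixedPointFreeTargets`, which asks this for one prime and
all `r ≤ (p^k)^(2+δ)`). [cite: tomDieck1987, ch. I] -/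
def TargetsBelow (L : ℕ → ℕ) : Prop :=
  ∀ p : ℕ, ∀ _ : Fact p.Prime, ∃ k₀ : ℕ, ∀ k : ℕ, k₀ ≤ k → ∀ (P : (Fin k → ZMod p) → (Fin k → ZMod p) → Matrix (Fin k → ZMod p) (Fin k → ZMod p) ℂ), (∀ x z u v, P x z u v = if u = v + x then Complex.exp (2 * Real.pi * Complex.I * ((∑ i, z i * v i).val : ℂ) / (p : ℂ)) else 0) → ∀ (act : ((Fin k → ZMod p) × (Fin k → ZMod p)) × ((Fin k → ZMod p) × (Fin k → ZMod p)) × ((Fin k → ZMod p) × (Fin k → ZMod p)) → (((Fin k → ZMod p) × (Fin k → ZMod p)) → ((Fin k → ZMod p) × (Fin k → ZMod p)) → ((Fin k → ZMod p) × (Fin k → ZMod p)) → ℂ) → (((Fin k → ZMod p) × (Fin k → ZMod p)) → ((Fin k → ZMod p) × (Fin k → ZMod p)) → ((Fin k → ZMod p) × (Fin k → ZMod p)) → ℂ)), (∀ g x a b c, act g x a b c = ∑ a', ∑ b', ∑ c', (starRingEnd ℂ (P g.1.1 g.1.2 a.1 a'.1) * P g.2.2.1 g.2.2.2 a.2 a'.2)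 * (P g.1.1 g.1.2 b.1 b'.1 * starRingEnd ℂ (P g.2.1.1 g.2.1.2 b.2 b'.2)) * (P g.2.1.1 g.2.1.2 c.1 c'.1 * starRingEnd ℂ (P g.2.2.1 g.2.2.2 c.2 c'.2)) * x a' b' c') → ∀ r : ℕ, r < L (p ^ k) → ∃ (d : ℕ) (ρ : ((Fin k → ZMod p) × (Fin k → ZMod p)) × ((Fin k → ZMod p) × (Fin k → ZMod p)) × ((Fin k → ZMod p) × (Fin k → ZMod p)) → Matrix (Fin d) (Fin d) ℂ) (f : (((Fin k → ZMod p) × (Fin k → ZMod p)) → ((Fin k → ZMod p) × (Fin k → ZMod p)) → ((Fin k → ZMod p) × (Fin k → ZMod p)) → ℂ) → (Fin d → ℂ)), ρ 0 = 1 ∧ (∀ g h, ρ (g + h) = ρ g * ρ h) ∧ (∀ w : Fin d → ℂ, (∀ g, (ρ g).mulVec w = w) → w = 0) ∧ ContinuousOn f {x | x ≠ 0 ∧ algBorderRank x ≤ r} ∧ (∀ x, x ≠ 0 → algBorderRank x ≤ r → f x ≠ 0) ∧ (∀ g x, algBorderRank x ≤ r → f (act g x) = (ρ g).mulVec (f 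x))

/-- A deficit rung gives targets below `2n² − t(n)` (levelwise dictionary
`targets_of_lt_algBorderRank`, in tree). [cite: tomDieck1987, ch. I] [cite: Blaser2013, §6] -/
theorem targetsBelow_of_deficitRung {t : ℕ → ℕ} (h : DeficitRung t) :
    TargetsBelow fun n => 2 * n ^ 2 - t n := by
  obtain ⟨n₀, hn₀⟩ := h
  intro p hp
  refine ⟨n₀, fun k hk P hP act hact r hr => PauliTautologicalTarget.targets_of_lt_algBorderRank hP hact ?_⟩
  have hk' : n₀ ≤ p ^ k := hk.trans (Nat.lt_pow_self hp.out.one_lt).le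
  have := hn₀ _ hk'
  dsimp only at hr
  omega

/-- **The rung in target language:** `BorderRankTwoNSquared` ⇒ for every prime `p`, eventually in `k`,
fixed-point-free `E`-targets exist at every level `r < 2(p^k)²`. [cite: Blaser2013, §6] -/
theorem targetsBelow_of_rung (h : BorderRankTwoNSquared) : TargetsBelow fun n => 2 * n ^ 2 :=
  by simpa using targetsBelow_of_deficitRung (borderRankTwoNSquared_iff_deficitRung_zero.1 h)

/-- **The floor in target language (unconditional):** targets at every level
`r < 2(p^k)² − ⌈log₂ p^k⌉ − 1`. [cite: LandsbergMichalek2018, Thm. 1.1] -/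
theorem targetsBelow_floor : TargetsBelow fun n => 2 * n ^ 2 - (Nat.clog 2 n + 1) :=
  targetsBelow_of_deficitRung deficitRung_floor

end Summit.MatrixMultiplication.MatrixMultiplication.Cruxes.FixedPointFreeTargets.BorderRankTwoNSquared

end
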